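import Summits.QuantumAdvantage.AdviceFreeQNC0.M19FormExpansion
import HarnessLib

/-!
# M19 part 4: THEOREM B `intervalLoss` (interval counters mod `p`)

PROVENANCE / PORT (ask P2-19a): authored by the planner seat qa-qnc0-p2 g19 (`HOME/qa-qnc0-p2/line19/M19Proofs.lean`, 1542 lines,
farm rc 0 / 0 sorry / 0 warnings), ported by qn-prover-3 g12 as six files `M19Linearisation` → `M19SegmentCounter` →
`M19FormExpansion` → `M19IntervalLoss` → `M19AffineTests` → `M19StepForms`; everything is placed in the namespace
`Summit.QuantumAdvantage.AdviceFreeQNC0.M19` (so `M19.winCount` / `M19.lossCount` do not shadow the cell's `AffBells22.winCount`),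
28 one-line docstrings were added, nothing else changed.  Separation NOT moved.
-/

/-! ## Theorem B — `K` interval counters mod `p` per cut (blocks of `2p` posts; pigeonhole on breakpoints):
constant loss `#LOSE ≥ 2^{n − 2p(2K+2)}` for every charge, from `n = 2p(2K+2)` on. -/

section IntervalB

namespace Summit.QuantumAdvantage.AdviceFreeQNC0.M19

open Finset

variable {F : Type} [Field F]

/-- the counter of an interval `[a, b)` of positions (Sketch19): `#{a ≤ i < b : u_i = 1}`. -/
def wtInterval {n : ℕ} (u : Fin n → Bool) (a b : ℕ) : ℕ :=
  (univ.filter fun i : Fin n => a ≤ i.val ∧ i.val < b ∧ u i = true).card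

/-- Theorem B class: cut `g` reads `K` interval counters mod `p` (intervals of its choice, possibly empty, nested or
overlapping), combined by an ARBITRARY Boolean function (the `J₀ = 0` part of Sketch19's `IsIntervalJuntaStrategy`; a junta
bit is an interval of length one, so juntas are covered with `K + J₀` intervals). Contains oblivious, prefix, suffix,
two-sided, segment, window and multi-window counters. -/
def IsIntervalStrategy (p K n : ℕ) (y : Fin (n + 1) → (Fin n → Bool) → Bool) : Prop :=
  ∀ g : Fin (n + 1), ∃ (a b : Fin K → ℕ), ∀ u v : Fin n → Bool,
      (∀ j : Fin K, wtInterval u (a j) (b j) % p = wtInterval v (a j) (b j) % p) → y g u = y g v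

/-- **Theorem B** (flag-less): `p` odd, `3 ∤ p`, `n ≥ 2p(2K+2)` ⇒ every `K`-interval strategy loses on `≥ 2^{n−2p(2K+2)}` inputs. -/
def IntervalLoss (p : ℕ) : Prop :=
  Odd p → ¬ 3 ∣ p → ∀ (K n c : ℕ) (y : Fin (n + 1) → (Fin n → Bool) → Bool),
    IsIntervalStrategy p K n y → 2 * p * (2 * K + 2) ≤ n → 2 ^ (n - 2 * p * (2 * K + 2)) ≤ lossCount c y

/-- `wtInterval` cast into an `AddCommMonoidWithOne`, as a gated sum. -/
theorem wtInterval_cast (R : Type) [AddCommMonoidWithOne R] {n : ℕ} (u : Fin n → Bool) (a b : ℕ) :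
    (wtInterval u a b : R)
      = ∑ i : Fin n, (if u i = true then (if a ≤ i.val ∧ i.val < b then (1 : R) else 0) else 0) := by
  unfold wtInterval
  rw [Finset.card_filter]
  push_cast
  refine Finset.sum_congr rfl (fun i _ => ?_)
  by_cases hu : u i = true <;> by_cases h1 : a ≤ i.val <;> by_cases h2 : i.val < b <;> simp [hu, h1, h2]

variable {p : ℕ} [NeZero p] (ψ : AddChar (ZMod p) F) (η : F)

/-- the block alphabet: position `q < 2p` of a block carries `ψ(q)·η` (`q < p`) or `ψ(q−p)·η²` (`p ≤ q`). -/
def blockLetter (p : ℕ) (ψ : AddChar (ZMod p) F) (η : F) (q : ℕ) : F :=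
  if q < p then ψ (q : ZMod p) * η ^ 1 else ψ ((q - p : ℕ) : ZMod p) * η ^ 2

omit [NeZero p] in
/-- Block letters are `≠ 1`. -/
theorem blockLetter_ne_one (hη : IsPrimitiveRoot η 3) (h3 : ¬ 3 ∣ p) (hψp : ∀ z : ZMod p, (ψ z) ^ p = 1) (q : ℕ) :
    blockLetter p ψ η q ≠ 1 := by
  unfold blockLetter
  split_ifs
  · exact psi_mul_eta_pow_ne_one ψ η hη h3 hψp _ 1 (Or.inl rfl)
  · exact psi_mul_eta_pow_ne_one ψ η hη h3 hψp _ 2 (Or.inr rfl)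

/-- every letter `ψ(z)·η^e`, `e ∈ {1,2}`, occurs in every block. -/
theorem block_carries (z : ZMod p) (e : ℕ) (he : e = 1 ∨ e = 2) :
    ∃ q, q < 2 * p ∧ blockLetter p ψ η q = ψ z * η ^ e := by
  have hz : z.val < p := z.val_lt
  rcases he with rfl | rfl
  · refine ⟨z.val, by omega, ?_⟩
    unfold blockLetter
    rw [if_pos hz, ZMod.natCast_zmod_val]
  · refine ⟨p + z.val, by omega, ?_⟩
    unfold blockLetter
    rw [if_neg (by omega), Nat.add_sub_cancel_left, ZMod.natCast_zmod_val]

omit [NeZero p] in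
/-- the label factor of a letter is `η` or `η²`. -/
theorem label_letter (hη3 : η ^ 3 = 1) (b : Fin 2) (P : Prop) [Decidable P] :
    ∃ e, (e = 1 ∨ e = 2) ∧ (if P then η ^ (b.val + 1) else 1) * η ^ (b.val + 1) = η ^ e := by
  have hη4 : η ^ 4 = η := by
    calc η ^ 4 = η ^ 3 * η := by ring
      _ = η := by rw [hη3, one_mul]
  fin_cases b <;> by_cases h : P
  · exact ⟨2, Or.inr rfl, by simp only [h, if_true]; ring⟩
  · exact ⟨1, Or.inl rfl, by simp only [h, if_false]; ring⟩
  · refine ⟨1, Or.inl rfl, ?_⟩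
    simp only [h, if_true]
    calc _ = η ^ 3 * η := by ring
      _ = η ^ 1 := by rw [hη3]; ring
  · exact ⟨2, Or.inr rfl, by simp only [h, if_false]; ring⟩

/-- **The block design hits every term**: among `2K+2` blocks of `2p` consecutive coordinates at most `2K+1` contain a
breakpoint (an interval endpoint or the cut) in their interior; on a free block the letter of the term is constant and the
block carries it. -/
theorem interval_hit (hη3 : η ^ 3 = 1) {n K : ℕ} (hn : 2 * p * (2 * K + 2) ≤ n)
    (a b : Fin (n + 1) → Fin K → ℕ) (g : Fin (n + 1)) (cv : Fin K → ZMod p) (bb : Fin 2) :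
    ∃ i ∈ (univ : Finset (Fin (2 * p * (2 * K + 2)))).map (Fin.castLEEmb hn),
      formρ ψ η (fun g j i => if a g j ≤ i.val ∧ i.val < b g j then (1 : ZMod p) else 0) g cv bb i
        = blockLetter p ψ η (i.val % (2 * p)) := by
  classical
  have hp : 0 < p := NeZero.pos p
  -- breakpoints and a free block
  set Bk : Finset ℕ := (univ.image fun j : Fin K => a g j) ∪ (univ.image fun j : Fin K => b g j) ∪ {g.val} with hBk
  have hcard : (Bk.image fun t => (t - 1) / (2 * p)).card < (Finset.range (2 * K + 2)).card := by
    rw [Finset.card_range]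
    calc (Bk.image fun t => (t - 1) / (2 * p)).card ≤ Bk.card := Finset.card_image_le
      _ ≤ K + K + 1 := by
          rw [hBk]
          refine (Finset.card_union_le _ _).trans ?_
          rw [Finset.card_singleton]
          refine Nat.add_le_add_right ((Finset.card_union_le _ _).trans (Nat.add_le_add ?_ ?_)) 1
          · exact Finset.card_image_le.trans (by rw [Finset.card_univ, Fintype.card_fin])
          · exact Finset.card_image_le.trans (by rw [Finset.card_univ, Fintype.card_fin])
      _ < 2 * K + 2 := by omega
  obtain ⟨m, hm, hnot⟩ := Finset.exists_mem_notMem_of_card_lt_card hcard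
  rw [Finset.mem_range] at hm
  have hfree : ∀ t ∈ Bk, ¬ (2 * p * m < t ∧ t < 2 * p * m + 2 * p) := by
    intro t ht hlt
    apply hnot
    rw [Finset.mem_image]
    refine ⟨t, ht, ?_⟩
    obtain ⟨hlt1, hlt2⟩ := hlt
    refine Nat.div_eq_of_lt_le ?_ ?_
    · rw [Nat.mul_comm m (2 * p)]; omega
    · rw [Nat.add_mul, Nat.mul_comm m (2 * p)]; omega
  have ha : ∀ j, ¬ (2 * p * m < a g j ∧ a g j < 2 * p * m + 2 * p) := fun j =>
    hfree _ (by rw [hBk]; simp)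
  have hb : ∀ j, ¬ (2 * p * m < b g j ∧ b g j < 2 * p * m + 2 * p) := fun j =>
    hfree _ (by rw [hBk]; simp)
  have hg : ¬ (2 * p * m < g.val ∧ g.val < 2 * p * m + 2 * p) := hfree _ (by rw [hBk]; simp)
  have hblk : 2 * p * m + 2 * p ≤ 2 * p * (2 * K + 2) := by
    have := Nat.mul_le_mul_left (2 * p) (show m + 1 ≤ 2 * K + 2 by omega)
    rw [Nat.mul_succ] at this
    exact this
  -- the letter on the free block, and the post of the block carrying it
  set z : ZMod p := ∑ j, cv j * (if a g j ≤ 2 * p * m ∧ 2 * p * m < b g j then (1 : ZMod p) else 0) with hz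
  obtain ⟨e, he, hlab⟩ := label_letter η hη3 bb (2 * p * m < g.val)
  obtain ⟨q, hq, hql⟩ := block_carries ψ η z e he
  refine ⟨Fin.castLE hn ⟨2 * p * m + q, by omega⟩,
    Finset.mem_map.mpr ⟨⟨2 * p * m + q, by omega⟩, Finset.mem_univ _, rfl⟩, ?_⟩
  have hmod : (2 * p * m + q) % (2 * p) = q := by
    rw [Nat.mul_add_mod]
    exact Nat.mod_eq_of_lt hq
  show ψ (∑ j, cv j * (if a g j ≤ 2 * p * m + q ∧ 2 * p * m + q < b g j then (1 : ZMod p) else 0))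
      * ((if 2 * p * m + q < g.val then η ^ (bb.val + 1) else 1) * η ^ (bb.val + 1))
      = blockLetter p ψ η ((2 * p * m + q) % (2 * p))
  have h1 : (∑ j, cv j * (if a g j ≤ 2 * p * m + q ∧ 2 * p * m + q < b g j then (1 : ZMod p) else 0)) = z := by
    rw [hz]
    refine Finset.sum_congr rfl (fun j _ => ?_)
    have haj := ha j
    have hbj := hb j
    congr 1
    refine if_congr ?_ rfl rfl
    constructor
    · rintro ⟨h₁, h₂⟩; constructor <;> omega
    · rintro ⟨h₁, h₂⟩; constructor <;> omega
  have h2 : (2 * p * m + q < g.val) ↔ (2 * p * m < g.val) := by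
    constructor
    · intro h; omega
    · intro h; omega
  rw [hmod, hql, h1, if_congr h2 rfl rfl, hlab]

/-- **Theorem B, kernel form.** -/
theorem intervalLoss (p : ℕ) : IntervalLoss p := by
  intro hp h3 K n c y hy hn
  classical
  haveI : NeZero p := ⟨by obtain ⟨k, hk⟩ := hp; omega⟩
  obtain ⟨F, instF, instC, η, ξ, hη, hξ⟩ := exists_charTwo_field_with_roots p hp
  have hη3 : η ^ 3 = 1 := hη.pow_eq_one
  have hη1 : η ≠ 1 := hη.ne_one (by norm_num)
  let ψ : AddChar (ZMod p) F := AddChar.zmodChar p hξ.pow_eq_one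
  have hψ : ∀ z : ZMod p, ψ z = ξ ^ z.val := fun z => AddChar.zmodChar_apply _ z
  have hψp : ∀ z : ZMod p, (ψ z) ^ p = 1 := by
    intro z
    rw [hψ, ← pow_mul, mul_comm, pow_mul, hξ.pow_eq_one, one_pow]
  choose a b hab using hy
  -- coefficient system, offsets and tables
  let L : Fin (n + 1) → Fin K → Fin n → ZMod p := fun g j i => if a g j ≤ i.val ∧ i.val < b g j then 1 else 0
  let β : Fin (n + 1) → Fin K → ZMod p := fun _ _ => 0
  let f : Fin (n + 1) → (Fin K → ZMod p) → Bool := fun g r =>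
    decide (∃ v : Fin n → Bool, (fun j => (wtInterval v (a g j) (b g j) : ZMod p)) = r ∧ y g v = true)
  have hform : ∀ g u, (fun j => β g j + ∑ i, (if u i = true then L g j i else 0))
      = fun j => (wtInterval u (a g j) (b g j) : ZMod p) := by
    intro g u
    funext j
    rw [wtInterval_cast, zero_add]
  have hf : ∀ g u, y g u = f g (fun j => β g j + ∑ i, (if u i = true then L g j i else 0)) := by
    intro g u
    rw [hform g u]
    cases hyu : y g u
    · symm
      apply decide_eq_false
      rintro ⟨v, h1, h2⟩
      have hsame := hab g u v (fun j =>
        ((ZMod.natCast_eq_natCast_iff' _ _ _).mp (congrFun h1 j)).symm)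
      rw [hyu, h2] at hsame
      exact Bool.false_ne_true hsame
    · symm
      apply decide_eq_true
      exact ⟨u, rfl, hyu⟩
  -- posts: the first 2p(2K+2) coordinates, block alphabet repeated
  have hP : ((Finset.univ : Finset (Fin (2 * p * (2 * K + 2)))).map (Fin.castLEEmb hn)).card
      = 2 * p * (2 * K + 2) := by simp
  have key := loss_ge_of_posts c y (Fin (n + 1) × (Fin K → ZMod p) × (Fin K → ZMod p) × Fin 2) Finset.univ
    (fun t => formC ψ η c f β t.1 t.2.1 t.2.2.1 t.2.2.2) (fun t => formρ ψ η L t.1 t.2.2.1 t.2.2.2)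
    ((Finset.univ : Finset (Fin (2 * p * (2 * K + 2)))).map (Fin.castLEEmb hn))
    (fun i => blockLetter p ψ η (i.val % (2 * p)))
    (fun i _ => blockLetter_ne_one ψ η hη h3 hψp _)
    (fun t _ => interval_hit ψ η hη3 hn a b t.1 t.2.2.1 t.2.2.2)
    (form_expansion ψ η hη3 hη1 hp hξ hψ c y L β f hf)
  rw [hP] at key
  exact key

/-- **Theorem B, θ-form**: `K`-interval strategies win at most `(1 − 2^{−2p(2K+2)})·2ⁿ` from `n = 2p(2K+2)` on. -/
theorem interval_theta (p K : ℕ) (hp : Odd p) (h3 : ¬ 3 ∣ p) :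
    ∃ θ : ℝ, θ < 1 ∧ ∃ n₀ : ℕ, ∀ n ≥ n₀, ∀ c : ℕ, ∀ y : Fin (n + 1) → (Fin n → Bool) → Bool,
      IsIntervalStrategy p K n y →
        ((Finset.univ.filter fun u : Fin n → Bool => ringWinU c y u = true).card : ℝ) ≤ θ * (2 : ℝ) ^ n := by
  refine ⟨1 - 1 / 2 ^ (2 * p * (2 * K + 2)), by
    have : (0 : ℝ) < 1 / 2 ^ (2 * p * (2 * K + 2)) := by positivity
    linarith, 2 * p * (2 * K + 2), ?_⟩
  intro n hn c y hy
  exact win_le_of_loss_ge (winCount_add_lossCount c y) hn (intervalLoss p hp h3 K n c y hy hn)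

end Summit.QuantumAdvantage.AdviceFreeQNC0.M19

end IntervalB
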